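import Literature.MathematicalPhysics.QuantumFieldTheory.Balaban1983to89.B7Prop2SpecialUnitarySharpRec

/-!
# `Balaban1983to89.B7Prop2SpecialUnitaryDichotomyRec` — [Balaban1985Averaging] p. 20 ∕ [Balaban1987RG1] (0.4) FOR `G = SU(N)`: THE EXACT `N`-RANGE OF THE RECORD CLOSURE
# `AvgClosedZ d L (SU(N))` (radius `¼`) IS `N ≤ 25` — the NEGATIVE side on the RECORD loop family (one-bond central twist), for every `d ≥ 2`, `L ≥ 2`

statement-level skeleton of published theorems with citation tags; proofs where landed; nothing here is a claim about the Yang–Mills mass gap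

CITATION HEADER (lean-in-tree rule).  Cell `pub-ymgap` (HUMAN RULING D-0062), «N05-REC» road; director-ym №304 Q-304 (Q1) ∕ №305 (⚑ LOCATED-RANGE «SU(N), N ≤ 12» of the record SU crown —
VOID FOR TRACK A (N = 2), LADDER note b114); pen dag-n05-e g41.  [3] = [Balaban1985Averaging] p. 20 («the group `G` is obtained by applying the function `e^{iA}` to `A ∈ 𝔤`»),
(9) p. 18, (20)–(23) p. 21, (42)–(43) pp. 23–24, (52) p. 26 (`paper:balaban1985-cmp98-averaging`); [I] = [Balaban1987RG1] (0.3)–(0.4) pp. 252–253.  `--kind proof --supports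
stmt-QuantumFields-20541` (K0⁷; count-neutral; no definition).
REUSED BY NAME: the record average `BlockAveragingZd.{offZ, IdxZ, WZ, XZ, bavgZ}` and its word bookkeeping `T4Continuum.{stairWord, loopWord, wordRev, netDisp_take_stairWord,
netDisp_take_wordRev, netDisp_take_replicate, netDisp_stairWord, netDisp_wordRev}`, the engine's parallel transport `B7Prop1Explicit.{hol, stepHol, disp}`, the engine's central
witness `B7Prop2SpecialUnitary.{ZU, ZU_mem, norm_ZU_sub_one, mlog_ZU, thetaN, natCast_mul_thetaN}` (`Z = e^{2πi∕N}·1`), `ExpMeanLog.exp_smul_one_eq`, the positive side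
`B7Prop2SpecialUnitarySharpRec.avgClosedZ_specialUnitary_fin_of_le (N ≤ 25)`.

WHY THIS FILE.  The record SU crown (`B8Prop6DentedCubeMemberScalarGammaSU25Rec`, every `N ≤ 25`) takes its rank cap ONLY from the record closure hypothesis `hGA : AvgClosedZ d L SU(N)`
of the N05-REC chain (radius `¼` baked into `B7Prop2Rec.AvgClosedZ`).  The engine refutes its own radius-`¼` closure for `N ≥ 26` at `(d, L) = (2, 2)` only
(`B7Prop2SpecialUnitary.not_avgClosed_specialUnitary`); THIS FILE refutes the RECORD closure for `N ≥ 26` at EVERY `d ≥ 2`, `L ≥ 2` — in particular at the crown's `d = 4`, odd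
`L ≥ 5` — so NO instantiation of the present record chain yields an SU crown above `N = 25`: the `N`-free edition needs the closure RADIUS threaded through the chain (cell bus, Q1-c).
THE WITNESS (one-bond central twist).  `V ≡ 1` except on the single bond `b₀ = ⟨x₀, x₀ + e_κ₀⟩`, `x₀ = (M, …, M)`, `M = L − 1 − ⌊(L−1)∕2⌋ ≥ 1` (the largest centred offset), where
`V(b₀) = Z = e^{2πi∕N}·1 ∈ SU(N)` is CENTRAL.  For the coarse bond `c = ⟨0, L e_κ₀⟩` every loop `Γ ∪ [x, x′] ∪ (−Γ′) ∪ (−c)` of (0.4) (`x = n = offZ r`, all staircases `σ, σ′`)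
misses `b₀` along `Γ` (κ₀-coordinates `≤ M`), along `−Γ′` (κ₀-coordinates `≥ L − ⌊(L−1)∕2⌋ = M + 1`) and along `−c` (transverse coordinates `0 ≠ M`), and crosses it along the
transported bond `[x, x′]` exactly when `n_ν = M` for every `ν ≠ κ₀` (then once, forward).  Hence the loop variables are `Z` on one transverse fibre of the index set and `1`
elsewhere — all within `2π∕N ≤ ¼` of `1` — and `X_c = (k∕|Idx|)·(2πi∕N)·1` with `0 < k < |Idx|`, so `det V̄_c = e^{2πik∕|Idx|} ≠ 1`: `V̄_c ∉ SU(N)`.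

WHAT IS PROVED (sorry-free).  §1 generic single-twist transport lemmas for a configuration that is `1` off one bond (any group): `stepHol`∕`hol` are `1` along any walk none of
whose positions is `x₀ + e_κ₀` (resp. `x₀`), and a straight run through `b₀` picks up exactly the twist (`hol_replicate_true_through`); §2 ★ `WZ_single_twist` — the record loop
variables (0.4) of the witness; §3 ★★ `not_avgClosedZ_specialUnitary (26 ≤ N) (2 ≤ d) (2 ≤ L)`; §4 ★★ `avgClosedZ_specialUnitary_iff : AvgClosedZ d L SU(N) ↔ N ≤ 25` (`d ≥ 2`,
`L ≥ 2`, `[NeZero N]`) — THE EXACT DICHOTOMY OF THE RECORD INTERFACE.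
HONEST SCOPE.  Group-membership bookkeeping about OUR typed closure predicate at its fixed radius `¼`; it says nothing against Bałaban's construction, whose loop variables are
`O((d+1)(d+4)L²α₀)`-close to `1` where `SU(N)` is closed for every `N` (`B7Prop2SpecialUnitarySharpRec.bavgZ_mem_specialUnitaryUnits_of_lt_two_sin`); NO estimate of Bałaban's is
touched; `HThm4Rec` UNDISCHARGED; N05 ∕ N07 NOT discharged; counts unmoved (typed 28∕28 · discharged 8∕28); one finite 𝕋⁴ programme at fixed ε, `G = SU(2)` of record — nothing
continuum ∕ ℝ⁴ ∕ OS ∕ mass gap ∕ Clay.  No `def`, no `instance`, no `notation`, no `sorry`.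
-/

set_option autoImplicit false

noncomputable section

open scoped BigOperators
open NormedSpace Finset

namespace Literature.MathematicalPhysics.QuantumFieldTheory.Balaban1983to89.B7Prop2SpecialUnitaryDichotomyRec

open B7Prop1Explicit hiding Site
open B7Prop1Explicit renaming Site → SiteZ
open MatrixLog (mlog mlog_one)
open T4Continuum (netDisp stairWord loopWord wordRev netDisp_stairWord netDisp_wordRev netDisp_take_stairWord netDisp_take_wordRev
  netDisp_take_replicate)
open BlockAveragingZd (IdxZ WZ WZ_def XZ bavgZ bavgZ_apply offZ offZ_apply offZ_bounds disp_eq_netDisp)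
open B7Prop2Rec (AvgClosedZ)
open B7Prop2SpecialUnitary (specialUnitaryUnits mem_specialUnitaryUnits thetaN ZU ZU_mem norm_ZU_sub_one mlog_ZU natCast_mul_thetaN)
open B7Prop2SpecialUnitarySharpRec (avgClosedZ_specialUnitary_fin_of_le)

variable {d : ℕ}

/-! ## §1  Parallel transport of a configuration that is `1` off ONE bond `b₀ = ⟨x₀, x₀ + e_κ₀⟩` (any group) -/

section SingleTwist

variable {G : Type*} [Group G]
variable {V : SiteZ d → Fin d → G} {x₀ : SiteZ d} {κ₀ : Fin d}

/-- A step none of whose two endpoints' configuration is `x₀ + e_κ₀` does not read the bond `b₀ = ⟨x₀, x₀ + e_κ₀⟩`: for a configuration `V ≡ 1` off `b₀`, the step variable (9)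
is `1` whenever neither the start `y` nor the end `y ± e_μ` is `x₀ + e_κ₀`. [cite: Balaban1985Averaging, (9) p.18] -/
theorem stepHol_eq_one_of_ne_top (hV : ∀ x μ, ¬ (x = x₀ ∧ μ = κ₀) → V x μ = 1) (y : SiteZ d) (l : Letter d)
    (h0 : y ≠ x₀ + e κ₀) (h1 : y + l.vec ≠ x₀ + e κ₀) : stepHol V y l = 1 := by
  obtain ⟨μ, b⟩ := l
  cases b
  · rw [stepHol_false]
    have : V (y - e μ) μ = 1 := by
      refine hV _ _ fun h => h0 ?_
      obtain ⟨hy, rfl⟩ := h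
      rw [← hy, sub_add_cancel]
    rw [this, inv_one]
  · rw [stepHol_true]
    refine hV _ _ fun h => h1 ?_
    obtain ⟨rfl, rfl⟩ := h
    simp [Letter.vec]

/-- A step none of whose two endpoints is `x₀` does not read `b₀ = ⟨x₀, x₀ + e_κ₀⟩` either. [cite: Balaban1985Averaging, (9) p.18] -/
theorem stepHol_eq_one_of_ne_base (hV : ∀ x μ, ¬ (x = x₀ ∧ μ = κ₀) → V x μ = 1) (y : SiteZ d) (l : Letter d)
    (h0 : y ≠ x₀) (h1 : y + l.vec ≠ x₀) : stepHol V y l = 1 := by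
  obtain ⟨μ, b⟩ := l
  cases b
  · rw [stepHol_false]
    have : V (y - e μ) μ = 1 := by
      refine hV _ _ fun h => h1 ?_
      obtain ⟨hy, rfl⟩ := h
      simp [Letter.vec, ← hy, sub_eq_add_neg]
    rw [this, inv_one]
  · rw [stepHol_true]
    exact hV _ _ fun h => h0 h.1

/-- **A walk none of whose positions is `x₀ + e_κ₀` transports `V ≡ 1` off `b₀` trivially**: `V(Γ) = 1` ((9) p. 18) as soon as `y + disp(Γ↾k) ≠ x₀ + e_κ₀` for every prefix.
[cite: Balaban1985Averaging, (9) p.18] -/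
theorem hol_eq_one_of_forall_ne_top (hV : ∀ x μ, ¬ (x = x₀ ∧ μ = κ₀) → V x μ = 1) :
    ∀ (y : SiteZ d) (w : List (Letter d)), (∀ k ≤ w.length, y + disp (w.take k) ≠ x₀ + e κ₀) → hol V y w = 1
  | y, [], _ => rfl
  | y, l :: w, h => by
    rw [hol_cons]
    have h0 : y ≠ x₀ + e κ₀ := by simpa using h 0 (Nat.zero_le _)
    have h1 : y + l.vec ≠ x₀ + e κ₀ := by simpa using h 1 (by simp)
    rw [stepHol_eq_one_of_ne_top hV y l h0 h1, one_mul]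
    refine hol_eq_one_of_forall_ne_top hV (y + l.vec) w fun k hk => ?_
    have := h (k + 1) (by simpa using hk)
    simpa [List.take_succ_cons, add_assoc] using this

/-- **A walk none of whose positions is `x₀` transports `V ≡ 1` off `b₀` trivially.** [cite: Balaban1985Averaging, (9) p.18] -/
theorem hol_eq_one_of_forall_ne_base (hV : ∀ x μ, ¬ (x = x₀ ∧ μ = κ₀) → V x μ = 1) :
    ∀ (y : SiteZ d) (w : List (Letter d)), (∀ k ≤ w.length, y + disp (w.take k) ≠ x₀) → hol V y w = 1
  | y, [], _ => rfl
  | y, l :: w, h => by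
    rw [hol_cons]
    have h0 : y ≠ x₀ := by simpa using h 0 (Nat.zero_le _)
    have h1 : y + l.vec ≠ x₀ := by simpa using h 1 (by simp)
    rw [stepHol_eq_one_of_ne_base hV y l h0 h1, one_mul]
    refine hol_eq_one_of_forall_ne_base hV (y + l.vec) w fun k hk => ?_
    have := h (k + 1) (by simpa using hk)
    simpa [List.take_succ_cons, add_assoc] using this

/-- **A straight run of `+e_κ₀` steps starting `t < R` steps before `x₀` picks up exactly the twist**: `V([x₀ − t e_κ₀, x₀ − t e_κ₀ + R e_κ₀]) = V(b₀)` for `V ≡ 1` off `b₀`.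
[cite: Balaban1985Averaging, (9) p.18] -/
theorem hol_replicate_true_through (hV : ∀ x μ, ¬ (x = x₀ ∧ μ = κ₀) → V x μ = 1) {t R : ℕ} (ht : t < R) :
    hol V (x₀ - (t : ℤ) • e κ₀) (List.replicate R (κ₀, true)) = V x₀ κ₀ := by
  obtain ⟨s, rfl⟩ : ∃ s, R = t + (s + 1) := ⟨R - t - 1, by omega⟩
  rw [List.replicate_add, hol_append, List.replicate_succ, hol_cons, disp_replicate, stepHol_true]
  have hpos : x₀ - (t : ℤ) • e κ₀ + (t : ℤ) • Letter.vec ((κ₀, true) : Letter d) = x₀ := by simp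
  rw [hpos]
  have h1 : hol V (x₀ - (t : ℤ) • e κ₀) (List.replicate t (κ₀, true)) = 1 := by
    refine hol_eq_one_of_forall_ne_top hV _ _ fun k hk => ?_
    rw [List.take_replicate, disp_replicate]
    intro h
    have := congr_fun h κ₀
    rw [List.length_replicate] at hk
    simp [e_apply, Letter.vec] at this
    omega
  have h2 : hol V (x₀ + Letter.vec ((κ₀, true) : Letter d)) (List.replicate s (κ₀, true)) = 1 := by
    refine hol_eq_one_of_forall_ne_base hV _ _ fun k _ => ?_
    rw [List.take_replicate, disp_replicate]
    intro h
    have := congr_fun h κ₀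
    simp [e_apply, Letter.vec] at this
    omega
  rw [h1, one_mul, h2, mul_one]

/-- A straight run of `±e_κ₀` steps whose transverse coordinate `ν ≠ κ₀` differs from `x₀ ν` never meets `b₀`. [cite: Balaban1985Averaging, (9) p.18] -/
theorem hol_replicate_eq_one_of_apply_ne (hV : ∀ x μ, ¬ (x = x₀ ∧ μ = κ₀) → V x μ = 1) {ν : Fin d} (hν : ν ≠ κ₀)
    {y : SiteZ d} (hy : y ν ≠ x₀ ν) (R : ℕ) (b : Bool) :
    hol V y (List.replicate R (κ₀, b)) = 1 := by
  refine hol_eq_one_of_forall_ne_base hV _ _ fun k _ h => hy ?_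
  have := congr_fun h ν
  rw [List.take_replicate, disp_replicate] at this
  cases b <;> simpa [e_apply, Letter.vec, hν] using this

end SingleTwist

/-! ## §2  The record loop variables (0.4) of the one-bond central twist -/

section RecordLoops

variable {G : Type*} [Group G]

/-- `disp = netDisp` as lattice vectors (the engine's and NODE 00's bookkeeping of (9)'s contours). [cite: Balaban1985Averaging, (9) p.18] -/
theorem disp_eq_fun_netDisp (w : List (Letter d)) : disp w = fun ν => netDisp w ν :=
  funext (disp_eq_netDisp w)

/-- ★ **The record loop variables (0.4) of the one-bond central twist.**  `V ≡ 1` off `b₀ = ⟨x₀, x₀ + e_κ₀⟩`, `x₀ = (M, …, M)`, `M = L − 1 − ⌊(L−1)∕2⌋` (`L ≥ 2`); coarse bond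
`c = ⟨0, L e_κ₀⟩`.  Then for every index `i = (r, σ, σ′)` of (0.4): `V(Γ ∪ [x,x′] ∪ (−Γ′) ∪ (−c)) = V(b₀)` if the centred offset `n = offZ r` has `n_ν = M` for all `ν ≠ κ₀`, and `= 1`
otherwise — the staircase `Γ ∈ G(0, n)` keeps κ₀-coordinates in `[min(0,n_κ₀), max(0,n_κ₀)] ⊆ [−⌊(L−1)∕2⌋, M]` (never at `M + 1`), `−Γ′` keeps them `≥ L − ⌊(L−1)∕2⌋ = M + 1` (never at
`M`), `−c` has transverse coordinates `0 ≠ M`, and `[x, x′] = [n, n + L e_κ₀]` passes through `x₀` iff `n_⊥ = (M, …, M)` (its κ₀-range `[n_κ₀, n_κ₀ + L]` always contains `M`).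
[cite: Balaban1987RG1, (0.3)–(0.4) pp.252–253; Balaban1985Averaging, (9) p.18] -/
theorem WZ_single_twist {L : ℕ} (hL : 2 ≤ L) {κ₀ ν₁ : Fin d} (hν₁ : ν₁ ≠ κ₀) {M : ℤ} (hM : M = (L : ℤ) - 1 - (((L - 1) / 2 : ℕ) : ℤ))
    {V : SiteZ d → Fin d → G} (hV : ∀ x μ, ¬ (x = (fun _ => M) ∧ μ = κ₀) → V x μ = 1) (i : IdxZ d L) :
    WZ L V 0 κ₀ i = if (∀ ν, ν ≠ κ₀ → offZ L i.1 ν = M) then V (fun _ => M) κ₀ else 1 := by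
  classical
  obtain ⟨r, σ, σ'⟩ := i
  set n : SiteZ d := offZ L r with hn
  set x₀ : SiteZ d := fun _ => M with hx₀
  have hs2 : (((L - 1) / 2 : ℕ) : ℤ) + M = (L : ℤ) - 1 := by rw [hM]; ring
  have hM1 : 1 ≤ M := by
    rw [hM]; have : ((L - 1) / 2 : ℕ) + 1 ≤ L - 1 := by omega
    have hL1 : 1 ≤ L := by omega
    push_cast [Nat.cast_sub hL1] at this ⊢; omega
  have hnb : ∀ ν, -(((L - 1) / 2 : ℕ) : ℤ) ≤ n ν ∧ n ν ≤ M := fun ν => by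
    have := offZ_bounds L r ν; rw [hM]; exact this
  -- the four pieces of the loop word and their start positions
  rw [WZ_def]
  show hol V 0 (loopWord L κ₀ n σ σ') = _
  unfold loopWord
  have hdΓ : disp (stairWord σ n) = n := by
    rw [disp_eq_fun_netDisp]; funext ν; exact netDisp_stairWord σ n ν
  have hdrun : disp (List.replicate L ((κ₀, true) : Letter d)) = (L : ℤ) • e κ₀ := by
    rw [disp_replicate]; rfl
  have hdΓ' : disp (wordRev (stairWord σ' n)) = -n := by
    rw [disp_eq_fun_netDisp]; funext ν; rw [netDisp_wordRev, netDisp_stairWord]; rfl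
  rw [hol_append, hol_append, hol_append, zero_add, hdΓ, hdrun, hdΓ']
  -- (1) the staircase `Γ` from `0` to `n`: κ₀-coordinates `≤ M < M + 1`
  have h1 : hol V 0 (stairWord σ n) = 1 := by
    refine hol_eq_one_of_forall_ne_top hV _ _ fun k _ h => ?_
    have hk0 : netDisp ((stairWord σ n).take k) κ₀ = M + 1 := by
      have := congr_fun h κ₀
      simpa [hx₀, e_apply, disp_eq_netDisp] using this
    have hb := (netDisp_take_stairWord σ n κ₀ k).2
    have hn2 := (hnb κ₀).2
    omega
  -- (3) the reversed staircase `−Γ′` from `x′ = n + L e_κ₀`: κ₀-coordinates `≥ L − ⌊(L−1)/2⌋ = M + 1 > M`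
  have h3 : hol V (n + (L : ℤ) • e κ₀) (wordRev (stairWord σ' n)) = 1 := by
    refine hol_eq_one_of_forall_ne_base hV _ _ fun k _ h => ?_
    obtain ⟨m, hm⟩ := netDisp_take_wordRev (stairWord σ' n) k
    have hk0 : n κ₀ + (L : ℤ) + netDisp ((wordRev (stairWord σ' n)).take k) κ₀ = M := by
      have := congr_fun h κ₀
      simpa [hx₀, e_apply, disp_eq_netDisp] using this
    rw [hm κ₀, netDisp_stairWord] at hk0
    have hb := (netDisp_take_stairWord σ' n κ₀ m).1
    have hn1 := (hnb κ₀).1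
    omega
  -- (4) the coarse bond backwards from `L e_κ₀`: transverse coordinate `0 ≠ M`
  have h4 : hol V (n + (L : ℤ) • e κ₀ + -n) (List.replicate L ((κ₀, false) : Letter d)) = 1 := by
    refine hol_replicate_eq_one_of_apply_ne hV hν₁ ?_ L false
    have h0 : (n + (L : ℤ) • e κ₀ + -n) ν₁ = 0 := by simp [e_apply, hν₁]
    rw [h0, hx₀]
    show (0 : ℤ) ≠ M
    omega
  rw [h1, one_mul, h3, h4, mul_one, mul_one]
  -- (2) the transported bond `[x, x′]` from `n`
  split_ifs with hP
  · -- `n = x₀ − t e_κ₀` with `t = M − n_κ₀ < L`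
    obtain ⟨t, ht⟩ : ∃ t : ℕ, (t : ℤ) = M - n κ₀ := ⟨(M - n κ₀).toNat, Int.toNat_of_nonneg (by linarith [(hnb κ₀).2])⟩
    have htL : t < L := by
      have := (hnb κ₀).1; omega
    have hnx : n = x₀ - (t : ℤ) • e κ₀ := by
      funext ν
      by_cases hν : ν = κ₀
      · subst hν; simp [hx₀, e_apply]; omega
      · simp [hx₀, e_apply, hν, hP ν hν]
    rw [hnx, hol_replicate_true_through hV htL]
  · obtain ⟨ν, hν⟩ := not_forall.1 hP
    obtain ⟨hν, hnν⟩ := Classical.not_imp.1 hν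
    exact hol_replicate_eq_one_of_apply_ne hV hν (by simpa [hx₀] using hnν) L true

end RecordLoops

/-! ## §3  `SU(N)`, `N ≥ 26`, is NOT `AvgClosedZ d L` for any `d ≥ 2`, `L ≥ 2` -/

section Negative

open scoped Matrix.Norms.L2Operator

/-- ★★ **`SU(N)` IS NOT CLOSED UNDER THE RECORD AVERAGE (0.4) AT RADIUS `¼` FOR `N ≥ 26`, AT EVERY `d ≥ 2`, `L ≥ 2`.**  The one-bond central twist `V = Z·𝟙_{b₀} + 1·𝟙_{≠ b₀}`,
`Z = e^{2πi∕N}·1 ∈ SU(N)`, is `SU(N)`-valued; at the coarse bond `c = ⟨0, L e_κ₀⟩` all its loop variables are `Z` or `1` (§2), within `2π∕N ≤ ¼` of `1`; the exponent is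
`X_c = (k∕|Idx|)·(2πi∕N)·1` with `k` = the number of indices on the twisted transverse fibre, `0 < k < |Idx|`; so `V̄_c = e^{X_c}·V(c) = e^{2πik∕(N|Idx|)}·1` has
`det V̄_c = e^{2πik∕|Idx|} ≠ 1` — `V̄_c ∉ SU(N)`.  (Engine twin at `(d, L) = (2, 2)`: `B7Prop2SpecialUnitary.not_avgClosed_specialUnitary`.)
[cite: Balaban1985Averaging, p.20, (42) p.23, (52) p.26; Balaban1987RG1, (0.4) p.253] -/
theorem not_avgClosedZ_specialUnitary {N : ℕ} [NeZero N] (hN : 26 ≤ N) (hd : 2 ≤ d) {L : ℕ} (hL : 2 ≤ L) :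
    ¬ AvgClosedZ d L (specialUnitaryUnits (Fin N)) := by
  classical
  intro hG
  -- the data of the witness
  set κ₀ : Fin d := ⟨0, by omega⟩ with hκ₀
  set ν₁ : Fin d := ⟨1, by omega⟩ with hν₁
  have hne : ν₁ ≠ κ₀ := by simp [hκ₀, hν₁, Fin.ext_iff]
  set M : ℤ := (L : ℤ) - 1 - (((L - 1) / 2 : ℕ) : ℤ) with hM
  set x₀ : SiteZ d := fun _ => M with hx₀
  set V : SiteZ d → Fin d → (Matrix (Fin N) (Fin N) ℂ)ˣ := fun x μ => if x = x₀ ∧ μ = κ₀ then ZU N else 1 with hVdef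
  have hV : ∀ x μ, ¬ (x = x₀ ∧ μ = κ₀) → V x μ = 1 := fun x μ h => by simp only [hVdef, if_neg h]
  have hV0 : V x₀ κ₀ = ZU N := by simp only [hVdef, and_self, if_true]
  have hVmem : ∀ x μ, V x μ ∈ specialUnitaryUnits (Fin N) := fun x μ => by
    by_cases h : x = x₀ ∧ μ = κ₀
    · simp only [hVdef, if_pos h]; exact ZU_mem N
    · rw [hV x μ h]; exact (specialUnitaryUnits (Fin N)).one_mem
  -- the loop variables: `Z` on the twisted transverse fibre, `1` elsewhere
  set P : IdxZ d L → Prop := fun i => ∀ ν, ν ≠ κ₀ → offZ L i.1 ν = M with hPdef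
  have hW : ∀ i : IdxZ d L, WZ L V 0 κ₀ i = if P i then ZU N else 1 := fun i => by
    rw [WZ_single_twist hL hne rfl hV i, hV0]
  have hN10 : 10 ≤ N := le_trans (by norm_num) hN
  have hWnorm : ∀ i : IdxZ d L, ‖((WZ L V 0 κ₀ i : (Matrix (Fin N) (Fin N) ℂ)ˣ) : Matrix (Fin N) (Fin N) ℂ) - 1‖ ≤ 1 / 4 := by
    intro i
    rw [hW i]
    split_ifs
    · refine (norm_ZU_sub_one N).trans ?_
      have hNr : (26 : ℝ) ≤ N := by exact_mod_cast hN
      rw [div_le_iff₀ (by positivity)]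
      have := Real.pi_lt_d2
      nlinarith
    · rw [Units.val_one, sub_self, norm_zero]; norm_num
  have hmem := hG.bavgZ_mem V hVmem 0 κ₀ hWnorm
  -- the exponent `X_c = (k / |Idx|) • θ_N • 1`
  have hlog : ∀ i : IdxZ d L, mlog ((WZ L V 0 κ₀ i : (Matrix (Fin N) (Fin N) ℂ)ˣ) : Matrix (Fin N) (Fin N) ℂ) =
      if P i then thetaN N • (1 : Matrix (Fin N) (Fin N) ℂ) else 0 := fun i => by
    rw [hW i]
    split_ifs
    · exact mlog_ZU hN10
    · rw [Units.val_one, mlog_one]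
  set k : ℕ := (Finset.univ.filter P).card with hk
  have hX : XZ L V 0 κ₀ = ((((k : ℝ) / (Fintype.card (IdxZ d L) : ℝ) : ℝ) : ℂ) * thetaN N) • (1 : Matrix (Fin N) (Fin N) ℂ) := by
    unfold XZ
    simp_rw [hlog]
    rw [← Finset.smul_sum, Finset.sum_ite, Finset.sum_const_zero, add_zero, Finset.sum_const, ← hk,
      ← Nat.cast_smul_eq_nsmul ℂ, smul_smul, RCLike.real_smul_eq_coe_smul (K := ℂ), smul_smul]
    congr 1
    push_cast
    ring
  -- `0 < k < |Idx|`: the constant index `L − 1` is on the fibre, the constant index `0` is not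
  have hL1 : 1 ≤ L := by omega
  have hMoff : ∀ r : Fin d → Fin L, ∀ ν, offZ L r ν = M ↔ (r ν : ℕ) = L - 1 := fun r ν => by
    rw [offZ_apply, hM]
    have := (r ν).isLt
    constructor
    · intro h; have : ((r ν : ℕ) : ℤ) = (L : ℤ) - 1 := by linarith
      omega
    · intro h; rw [h]; push_cast [Nat.cast_sub hL1]; ring
  have hk1 : 0 < k := by
    rw [hk, Finset.card_pos]
    refine ⟨(fun _ => ⟨L - 1, by omega⟩, 1, 1), Finset.mem_filter.2 ⟨Finset.mem_univ _, fun ν _ => (hMoff _ ν).2 rfl⟩⟩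
  have hk2 : k < Fintype.card (IdxZ d L) := by
    rw [hk, ← Finset.card_univ]
    refine Finset.card_lt_card (Finset.filter_ssubset.2 ⟨(fun _ => ⟨0, by omega⟩, 1, 1), Finset.mem_univ _, ?_⟩)
    intro h
    have := (hMoff _ ν₁).1 (h ν₁ hne)
    simp at this
    omega
  have hcard : (0 : ℝ) < Fintype.card (IdxZ d L) := by exact_mod_cast lt_of_le_of_lt (Nat.zero_le _) hk2
  have hq0 : 0 < (k : ℝ) / (Fintype.card (IdxZ d L) : ℝ) := by
    have : (0 : ℝ) < k := by exact_mod_cast hk1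
    positivity
  have hq1 : (k : ℝ) / (Fintype.card (IdxZ d L) : ℝ) < 1 := by
    rw [div_lt_one hcard]; exact_mod_cast hk2
  -- `det V̄_c = e^{2πik/|Idx|}`
  have hseg : hol V 0 (seg κ₀ (L : ℤ)) = 1 := by
    rw [seg_natCast]
    refine hol_replicate_eq_one_of_apply_ne hV hne ?_ L true
    have hM1 : 1 ≤ M := by
      rw [hM]; have : ((L - 1) / 2 : ℕ) + 1 ≤ L - 1 := by omega
      push_cast [Nat.cast_sub hL1] at this ⊢; omega
    rw [Pi.zero_apply, hx₀]
    show (0 : ℤ) ≠ M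
    omega
  have hdet := (Matrix.mem_specialUnitaryGroup_iff.1 (mem_specialUnitaryUnits.1 hmem)).2
  rw [bavgZ_apply, Units.val_mul, hseg, Units.val_one, mul_one, val_expUnit, hX, ExpMeanLog.exp_smul_one_eq, Matrix.det_smul,
    Matrix.det_one, mul_one, Fintype.card_fin, ← Complex.exp_nat_mul] at hdet
  have harg : (N : ℂ) * (((((k : ℝ) / (Fintype.card (IdxZ d L) : ℝ) : ℝ)) : ℂ) * thetaN N) =
      ((((k : ℝ) / (Fintype.card (IdxZ d L) : ℝ) : ℝ)) : ℂ) * (2 * Real.pi * Complex.I) := by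
    rw [mul_left_comm, natCast_mul_thetaN]
  rw [harg] at hdet
  obtain ⟨m, hm⟩ := Complex.exp_eq_one_iff.1 hdet
  have h2πI : (2 * Real.pi * Complex.I : ℂ) ≠ 0 := by simp [Real.pi_ne_zero, Complex.I_ne_zero]
  have hqm : ((((k : ℝ) / (Fintype.card (IdxZ d L) : ℝ) : ℝ)) : ℂ) = (m : ℂ) := mul_right_cancel₀ h2πI hm
  have hqm' : (k : ℝ) / (Fintype.card (IdxZ d L) : ℝ) = (m : ℝ) := by exact_mod_cast hqm
  rw [hqm'] at hq0 hq1
  have h0 : (0 : ℤ) < m := by exact_mod_cast hq0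
  have h1 : m < (1 : ℤ) := by exact_mod_cast hq1
  omega

/-! ## §4  The exact dichotomy of the record interface -/

/-- ★★ **THE EXACT `N`-RANGE OF THE RECORD CLOSURE HYPOTHESIS: `AvgClosedZ d L (SU(N)) ↔ N ≤ 25`** for every `d ≥ 2`, `L ≥ 2` (`N ≥ 1`) — the positive side is
`B7Prop2SpecialUnitarySharpRec.avgClosedZ_specialUnitary_fin_of_le` (sharp trace lemma, `¼ < 2 sin(π∕N)`), the negative side §3's one-bond central twist.  Consequence for the ladder
note (director №305): the record SU crown `B8Prop6DentedCubeMemberScalarGammaSU25Rec` (`N ≤ 25`) is the most the present record chain can give through `hGA`; above `25` the closure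
RADIUS must be threaded through the chain. [cite: Balaban1985Averaging, p.20, (42)–(43) pp.23–24, (52) p.26; Balaban1987RG1, (0.4) p.253] -/
theorem avgClosedZ_specialUnitary_iff {N : ℕ} [NeZero N] (hd : 2 ≤ d) {L : ℕ} (hL : 2 ≤ L) :
    AvgClosedZ d L (specialUnitaryUnits (Fin N)) ↔ N ≤ 25 := by
  constructor
  · intro h
    by_contra hN
    exact not_avgClosedZ_specialUnitary (by omega) hd hL h
  · intro hN
    exact avgClosedZ_specialUnitary_fin_of_le d L hN

end Negative

end Literature.MathematicalPhysics.QuantumFieldTheory.Balaban1983to89.B7Prop2SpecialUnitaryDichotomyRec
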